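import Literature.NumberTheory.EllipticCurves.AnticyclotomicSignedMainConjectureTransfer
import Literature.NumberTheory.EllipticCurves.AnticyclotomicSignedSelmerModuleFiniteProofs
import Literature.NumberTheory.EllipticCurves.IwasawaAlgebraGenericSpecializationRankProofs
import HarnessLib

/-!
# Castella–Wan 2024, Lemma 6.7 (ranks and torsion characteristic ideals of the signed anticyclotomic Selmer
# modules): the RANK clauses REDUCED to their printed specialisation inputs — the [AH06, Lem. 1.2.6]
# step of the printed proof PROVED on the tree's carriers

`Proofs`-style companion of `AnticyclotomicSignedMainConjectureTransfer.lean` (the named fact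
`castellaWan2024_lemma67_finrank_torsionCharIdeal`, INPUTS row G66 of the BSD cell `pub/bsd-wall/bsd-inputs`;
consumer: crux `AnticyclotomicEisensteinDivisibility`, stmt-BirchSwinnertonDyer-20727, `stub_namedFactsSS`
conj. 6). THEOREMS ONLY (no definition, no named fact, no instance, no `sorry`). Written by the
literature-prover seat `bsd-input-cw24-lem67-thm68` (LADDER-BSD inputs→unconditional). HONEST FRAMING: this file
does NOT discharge the fact. It kernel-checks the LAST step of the printed proof — "same `ℤ_p`-rank after
specialisation at almost every height-one prime ⟹ same `Λ^ac`-rank" ([AH06, Lem. 1.2.6], via the tree theorem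
`IwasawaAlgebra.finrank_eq_add_finrank_of_lambdaInvariant_quotient_X_sub_C`) — so that the two RANK clauses
of Lemma 6.7 are closed MODULO exactly the specialisation statements print proves before invoking [AH06]
(Lemmas 6.5–6.6; (6.7)–(6.11) with [MR04, Thm. 4.1.13], [DDT94, Thm. 2.18], Prop. 3.8), typed INLINE as
hypotheses in the tree's currency (no new `def … : Prop`); the torsion-characteristic-ideal clause (2b) is
CARRIED as a hypothesis verbatim (its engine — the second half of [AH06, Lem. 1.2.6], specialisation LENGTHS
at all height-one primes — is not in the tree). No summit statement (Birch–Swinnerton-Dyer) is proved here.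

## The printed argument (Castella–Wan, accepted MS `paper:url-7157bd4f7b88`, pp. 28–29 = journal pp. 2622–2623)

Lemma 6.7: "(1) The modules `X_±` and `Sel_±(K, 𝐓^ac)` have the same `Λ^ac`-rank. (2) `rank_{Λac}(X^{rel,±})
= 1 + rank_{Λac}(X^{±,str})` and `char_{Λac}(X^{rel,±}_tors) = char_{Λac}(X^{±,str}_tors)`". Proof of (1):
"it suffices to show that for every height one prime `P ≠ pΛ^ac` outside a finite set `Σ_Λ` the modules
`X_±/PX_± = Hom_{ℤ_p}(Sel_±(K, 𝐀^ac)[P], ℚ_p/ℤ_p)`, `Sel_±(K, 𝐓^ac)/P Sel_±(K, 𝐓^ac)` have the same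
`ℤ_p`-rank. Since Lemma 6.6 gives that `Sel_±(K, T_P)` is the `π_P`-adic Tate module of `Sel_±(K, A_P)`,
… which by Lemma 6.5 implies the result." Proof of (2): "(6.9) `H¹_{rel,±}(K, A_P) ≃ (Φ_P/S_P) ⊕
H¹_{±,str}(K, A_P)`. Hence the `S_P`-coranks of `H¹_{rel,±}(K, A_P)` and `H¹_{±,str}(K, A_P)` differ by one,
and their quotient by the maximal divisible submodule have the same order. The argument in the proof of
[AH06, Lem. 1.2.6] … now allows us to conclude the proof of part (2), once we show that … (6.10), (6.11)
have finite kernel and cokernel … bounded". The "it suffices" / "[AH06] argument" for RANKS is the tree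
theorem used below, applied along the LINEAR height-one primes `P = (T − c)`, `c ∈ 𝔪_{ℤ_p}` (a sub-family
of print's "every `P ∉ Σ_Λ`", so the hypotheses below are WEAKER than what print proves).

## Contents

* `castellaWan2024_lemma67_rank_sgn_of_specialisationRanks` — clause (1) at fixed `(γ, ε)` from: `Sel_ε(K, 𝐓^ac)`
  finitely generated over `Λ` (silent in print; [PR00, §1.3.3] / §4.1) and "`rank_{ℤ_p} Sel_ε/(T − c) =
  rank_{ℤ_p} X_ε/(T − c)` for all but finitely many `c ∈ 𝔪_{ℤ_p}`" (Lemmas 6.5–6.6); finite generation of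
  `X_ε` is the tree theorem `AcSigned.X.module_finite_empty`.
* `castellaWan2024_lemma67_rank_relStr_of_specialisationRanks` — clause (2a) at fixed `(γ, ε)` from
  "`rank_{ℤ_p} X^{rel,ε}/(T − c) = 1 + rank_{ℤ_p} X^{ε,str}/(T − c)` for all but finitely many `c`" ((6.9)–(6.11)).
* `castellaWan2024_lemma67_finrank_torsionCharIdeal_of_specialisationRanks` — the named fact from the three
  specialisation inputs under its own binders, with clause (2b) carried.

References: [CastellaWan2023] Lemma 6.7 and its proof, Lemmas 6.5–6.6, (6.7)–(6.11) (MS pp. 27–29), Def. 5.1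
(MS p. 23), §6 standing hypotheses (MS p. 25); [AgboolaHoward2006] Lemma 1.2.6 (= Lemma 2.2.6 of
arXiv:math/0302319, p. 8); [MazurRubin2004] Thm. 4.1.13; [PerrinRiou1995Asterisque] §1.3.3.
-/

noncomputable section

-- the `letI` module structures on the carriers make `Ideal • Submodule` instance search slow
set_option synthInstance.maxHeartbeats 400000

open scoped Classical

open PowerSeries NumberField IsDedekindDomain Field
open Literature.NumberTheory.EllipticCurves Literature.NumberTheory.GaloisRepresentations
open Literature.NumberTheory.EllipticCurves.ModularForms Literature.NumberTheory.EllipticCurves.Castella2018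
open Literature.NumberTheory.EllipticCurves.IwasawaAlgebra

universe u

namespace Literature.NumberTheory.EllipticCurves.AcSigned

/-! ## §1 The rank clauses at fixed `(γ, ε)` -/

section Fixed

variable {K : Type u} [Field K] [NumberField K] {W : WeierstrassCurve K} [W.IsElliptic] {p : ℕ}
  [Fact p.Prime] {κ : ZpExtension K p} {γ : absoluteGaloisGroup K}

/-- **Lemma 6.7 (1) at fixed `(γ, ε)`, modulo its specialisation input**: if `Sel_ε(K, 𝐓^ac)` is finitely
generated over `Λ` and `rank_{ℤ_p} Sel_ε(K, 𝐓^ac)/(T − c) = rank_{ℤ_p} X_ε/(T − c)` for all but finitely many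
`c ∈ 𝔪_{ℤ_p}` (Castella–Wan: Lemmas 6.5–6.6), then `rank_Λ Sel_ε(K, 𝐓^ac) = rank_Λ X_ε` (print's "it suffices",
= [AH06, Lem. 1.2.6] for ranks: `IwasawaAlgebra.finrank_eq_add_finrank_of_lambdaInvariant_quotient_X_sub_C`
with `k = 0`; `X_ε` is finitely generated by `X.module_finite_empty`).
[cite: CastellaWan2023, Lemma 6.7 (1) and its proof (MS p. 28)] [cite: AgboolaHoward2006, Lemma 1.2.6] -/
theorem castellaWan2024_lemma67_rank_sgn_of_specialisationRanks (hγ : κ.IsTopGenerator γ) (ε : ℤˣ)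
    (hfg : letI := selmerLambdaAdic.moduleOfGen W p κ γ hγ (fun _ ↦ PCond.sgn ε)
      Module.Finite (IwasawaAlgebra p) (selmerLambdaAdic W p κ γ (fun _ ↦ .sgn ε)))
    (hA : letI := selmerLambdaAdic.moduleOfGen W p κ γ hγ (fun _ ↦ PCond.sgn ε)
      letI := X.moduleOfGen W p κ ∅ (fun _ ↦ PCond.sgn ε) hγ
      {c : ℤ_[p] | c ∈ IsLocalRing.maximalIdeal ℤ_[p] ∧
        lambdaInvariant p (selmerLambdaAdic W p κ γ (fun _ ↦ .sgn ε) ⧸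
            (Ideal.span {(PowerSeries.X - PowerSeries.C c : IwasawaAlgebra p)} •
              (⊤ : Submodule (IwasawaAlgebra p) (selmerLambdaAdic W p κ γ (fun _ ↦ .sgn ε))))) ≠
          lambdaInvariant p (X W p κ ∅ (fun _ ↦ .sgn ε) ⧸
            (Ideal.span {(PowerSeries.X - PowerSeries.C c : IwasawaAlgebra p)} •
              (⊤ : Submodule (IwasawaAlgebra p) (X W p κ ∅ (fun _ ↦ .sgn ε)))))}.Finite) :
    letI := selmerLambdaAdic.moduleOfGen W p κ γ hγ (fun _ ↦ PCond.sgn ε)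
    letI := X.moduleOfGen W p κ ∅ (fun _ ↦ PCond.sgn ε) hγ
    Module.finrank (IwasawaAlgebra p) (selmerLambdaAdic W p κ γ (fun _ ↦ .sgn ε)) =
      Module.finrank (IwasawaAlgebra p) (X W p κ ∅ (fun _ ↦ .sgn ε)) := by
  letI := selmerLambdaAdic.moduleOfGen W p κ γ hγ (fun _ ↦ PCond.sgn ε)
  letI := X.moduleOfGen W p κ ∅ (fun _ ↦ PCond.sgn ε) hγ
  haveI := hfg
  haveI := X.module_finite_empty W p κ (fun _ ↦ PCond.sgn ε) hγ
  have h := finrank_eq_add_finrank_of_lambdaInvariant_quotient_X_sub_C p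
    (M := selmerLambdaAdic W p κ γ (fun _ ↦ .sgn ε)) (N := X W p κ ∅ (fun _ ↦ .sgn ε)) 0
    (hA.subset fun c hc ↦ ⟨hc.1, fun h ↦ hc.2 (by rw [h, zero_add])⟩)
  rw [h, zero_add]

/-- **Lemma 6.7 (2), rank clause, at fixed `(γ, ε)`, modulo its specialisation input**: if
`rank_{ℤ_p} X^{rel at 𝔭, ε}/(T − c) = 1 + rank_{ℤ_p} X^{ε, str at 𝔭'}/(T − c)` for all but finitely many
`c ∈ 𝔪_{ℤ_p}` (Castella–Wan (6.9)–(6.11): the `S_P`-coranks differ by one, up to the bounded control maps),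
then `rank_Λ X^{rel,ε} = 1 + rank_Λ X^{ε,str}` ([AH06, Lem. 1.2.6] for ranks, `k = 1`; both duals are finitely
generated by `X.module_finite_empty`).
[cite: CastellaWan2023, Lemma 6.7 (2) and its proof, (6.9)–(6.11) (MS pp. 28–29)] [cite: AgboolaHoward2006, Lemma 1.2.6] -/
theorem castellaWan2024_lemma67_rank_relStr_of_specialisationRanks (hγ : κ.IsTopGenerator γ) (ε : ℤˣ)
    (𝔭 𝔭' : HeightOneSpectrum (𝓞 K))
    (hD : letI := X.moduleOfGen W p κ ∅ (PCond.at 𝔭 .rel (.sgn ε)) hγ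
      letI := X.moduleOfGen W p κ ∅ (PCond.at 𝔭' .str (.sgn ε)) hγ
      {c : ℤ_[p] | c ∈ IsLocalRing.maximalIdeal ℤ_[p] ∧
        lambdaInvariant p (X W p κ ∅ (PCond.at 𝔭 .rel (.sgn ε)) ⧸
            (Ideal.span {(PowerSeries.X - PowerSeries.C c : IwasawaAlgebra p)} •
              (⊤ : Submodule (IwasawaAlgebra p) (X W p κ ∅ (PCond.at 𝔭 .rel (.sgn ε)))))) ≠
          1 + lambdaInvariant p (X W p κ ∅ (PCond.at 𝔭' .str (.sgn ε)) ⧸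
            (Ideal.span {(PowerSeries.X - PowerSeries.C c : IwasawaAlgebra p)} •
              (⊤ : Submodule (IwasawaAlgebra p) (X W p κ ∅ (PCond.at 𝔭' .str (.sgn ε))))))}.Finite) :
    letI := X.moduleOfGen W p κ ∅ (PCond.at 𝔭 .rel (.sgn ε)) hγ
    letI := X.moduleOfGen W p κ ∅ (PCond.at 𝔭' .str (.sgn ε)) hγ
    Module.finrank (IwasawaAlgebra p) (X W p κ ∅ (PCond.at 𝔭 .rel (.sgn ε))) =
      1 + Module.finrank (IwasawaAlgebra p) (X W p κ ∅ (PCond.at 𝔭' .str (.sgn ε))) := by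
  letI := X.moduleOfGen W p κ ∅ (PCond.at 𝔭 .rel (.sgn ε)) hγ
  letI := X.moduleOfGen W p κ ∅ (PCond.at 𝔭' .str (.sgn ε)) hγ
  haveI := X.module_finite_empty W p κ (PCond.at 𝔭 .rel (.sgn ε)) hγ
  haveI := X.module_finite_empty W p κ (PCond.at 𝔭' .str (.sgn ε)) hγ
  exact finrank_eq_add_finrank_of_lambdaInvariant_quotient_X_sub_C p
    (M := X W p κ ∅ (PCond.at 𝔭 .rel (.sgn ε))) (N := X W p κ ∅ (PCond.at 𝔭' .str (.sgn ε))) 1 hD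

end Fixed

/-! ## §2 The named fact modulo its printed specialisation inputs (clause (2b) carried) -/

section Fact

variable {N : ℕ} {W : WeierstrassCurve ℚ} [W.IsGloballyMinimal] {K : Type} [Field K]
  [NumberField K] {p : ℕ} [Fact p.Prime] {κ : ZpExtension K p} {𝔭 𝔭' : HeightOneSpectrum (𝓞 K)}

/-- **Castella–Wan 2024, Lemma 6.7 — the named fact `castellaWan2024_lemma67_finrank_torsionCharIdeal` —
MODULO its printed specialisation inputs**, each taken under the fact's own binder block (`Setting`,
`N = N_E`, `N⁻ = 1`, `3 < p`, a topological generator `γ`, a sign `ε`):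
* `hC` — `Sel_ε(K, 𝐓^ac)` is a finitely generated `Λ^ac`-module (silent in print: `H¹(K, 𝐓^ac)` is
  finitely generated; [PR00, §1.3.3] / §4.1);
* `hA` — Lemma 6.7 (1)'s reduction (MS p. 28, from Lemmas 6.5–6.6): `X_ε/PX_ε` and `Sel_ε(K, 𝐓^ac)/P` have
  the same `ℤ_p`-rank for all but finitely many LINEAR height-one primes `P = (T − c)`, `c ∈ 𝔪_{ℤ_p}`;
* `hD` — (6.9)–(6.11) (MS p. 29; [MR04, Thm. 4.1.13], [DDT94, Thm. 2.18], Prop. 3.8, Lemma 6.5): the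
  `ℤ_p`-ranks of `X^{rel,ε}/P` and `X^{ε,str}/P` differ by one for all but finitely many linear `P`;
* `h2b` — clause (2b) `char_{Λac}(X^{rel,ε}_tors) = char_{Λac}(X^{ε,str}_tors)` CARRIED VERBATIM (print: the
  same (6.9)–(6.11) at ALL height-one `P` — "quotient by the maximal divisible submodule have the same order"
  — fed into the LENGTH half of [AH06, Lem. 1.2.6] with `pΛ` handled via `Q = (Y + p^m)`; that engine is not
  in the tree, so (2b) is not reduced here).
Given these, the fact follows from the tree's rank engine
(`IwasawaAlgebra.finrank_eq_add_finrank_of_lambdaInvariant_quotient_X_sub_C`) and `X.module_finite_empty`.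
This closes INPUTS row G66's rank clauses MODULO `hC ∧ hA ∧ hD` and carries (2b); BSD is not proved by this.
[cite: CastellaWan2023, Lemma 6.7 and its proof (MS pp. 28–29), Def. 5.1 (MS p. 23), §6 standing hypotheses (MS p. 25)]
[cite: AgboolaHoward2006, Lemma 1.2.6] [cite: PerrinRiou1995Asterisque, §1.3.3 (cited through CastellaWan2023, MS p. 30)] -/
theorem castellaWan2024_lemma67_finrank_torsionCharIdeal_of_specialisationRanks
    (hC : ∀ (_ : Setting W K p κ 𝔭 𝔭') (γ : absoluteGaloisGroup K) (hγ : κ.IsTopGenerator γ) (ε : ℤˣ),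
      letI := selmerLambdaAdic.moduleOfGen (W.baseChange K) p κ γ hγ (fun _ ↦ PCond.sgn ε)
      Module.Finite (IwasawaAlgebra p) (selmerLambdaAdic (W.baseChange K) p κ γ (fun _ ↦ .sgn ε)))
    (hA : ∀ (_ : Setting W K p κ 𝔭 𝔭'), (W.conductorNorm ℤ : ℕ) = N → SatisfiesHeegnerHypothesis N K →
      3 < p → ∀ (γ : absoluteGaloisGroup K) (hγ : κ.IsTopGenerator γ) (ε : ℤˣ),
      letI := selmerLambdaAdic.moduleOfGen (W.baseChange K) p κ γ hγ (fun _ ↦ PCond.sgn ε)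
      letI := X.moduleOfGen (W.baseChange K) p κ ∅ (fun _ ↦ PCond.sgn ε) hγ
      {c : ℤ_[p] | c ∈ IsLocalRing.maximalIdeal ℤ_[p] ∧
        lambdaInvariant p (selmerLambdaAdic (W.baseChange K) p κ γ (fun _ ↦ .sgn ε) ⧸
            (Ideal.span {(PowerSeries.X - PowerSeries.C c : IwasawaAlgebra p)} •
              (⊤ : Submodule (IwasawaAlgebra p)
                (selmerLambdaAdic (W.baseChange K) p κ γ (fun _ ↦ .sgn ε))))) ≠
          lambdaInvariant p (X (W.baseChange K) p κ ∅ (fun _ ↦ .sgn ε) ⧸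
            (Ideal.span {(PowerSeries.X - PowerSeries.C c : IwasawaAlgebra p)} •
              (⊤ : Submodule (IwasawaAlgebra p) (X (W.baseChange K) p κ ∅ (fun _ ↦ .sgn ε)))))}.Finite)
    (hD : ∀ (_ : Setting W K p κ 𝔭 𝔭'), (W.conductorNorm ℤ : ℕ) = N → SatisfiesHeegnerHypothesis N K →
      3 < p → ∀ (γ : absoluteGaloisGroup K) (hγ : κ.IsTopGenerator γ) (ε : ℤˣ),
      letI := X.moduleOfGen (W.baseChange K) p κ ∅ (PCond.at 𝔭 .rel (.sgn ε)) hγ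
      letI := X.moduleOfGen (W.baseChange K) p κ ∅ (PCond.at 𝔭' .str (.sgn ε)) hγ
      {c : ℤ_[p] | c ∈ IsLocalRing.maximalIdeal ℤ_[p] ∧
        lambdaInvariant p (X (W.baseChange K) p κ ∅ (PCond.at 𝔭 .rel (.sgn ε)) ⧸
            (Ideal.span {(PowerSeries.X - PowerSeries.C c : IwasawaAlgebra p)} •
              (⊤ : Submodule (IwasawaAlgebra p) (X (W.baseChange K) p κ ∅ (PCond.at 𝔭 .rel (.sgn ε)))))) ≠
          1 + lambdaInvariant p (X (W.baseChange K) p κ ∅ (PCond.at 𝔭' .str (.sgn ε)) ⧸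
            (Ideal.span {(PowerSeries.X - PowerSeries.C c : IwasawaAlgebra p)} •
              (⊤ : Submodule (IwasawaAlgebra p)
                (X (W.baseChange K) p κ ∅ (PCond.at 𝔭' .str (.sgn ε))))))}.Finite)
    (h2b : ∀ (_ : Setting W K p κ 𝔭 𝔭'), (W.conductorNorm ℤ : ℕ) = N → SatisfiesHeegnerHypothesis N K →
      3 < p → ∀ (γ : absoluteGaloisGroup K) (hγ : κ.IsTopGenerator γ) (ε : ℤˣ),
      X.torsionCharIdeal (W.baseChange K) p κ ∅ (PCond.at 𝔭 .rel (.sgn ε)) hγ =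
        X.torsionCharIdeal (W.baseChange K) p κ ∅ (PCond.at 𝔭' .str (.sgn ε)) hγ) :
    castellaWan2024_lemma67_finrank_torsionCharIdeal N W K p κ 𝔭 𝔭' := by
  intro hS hN hH hp γ hγ ε
  haveI : W.IsElliptic := hS.isElliptic
  haveI : (W.baseChange K).IsElliptic := inferInstanceAs (W.map (algebraMap ℚ K)).IsElliptic
  exact ⟨castellaWan2024_lemma67_rank_sgn_of_specialisationRanks hγ ε (hC hS γ hγ ε) (hA hS hN hH hp γ hγ ε),
    castellaWan2024_lemma67_rank_relStr_of_specialisationRanks hγ ε 𝔭 𝔭' (hD hS hN hH hp γ hγ ε),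
    h2b hS hN hH hp γ hγ ε⟩

end Fact

end Literature.NumberTheory.EllipticCurves.AcSigned

end
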